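import Mathlib
import Literature.Geometry.Lorentzian.TeukolskyJostRemainderBound
import Literature.Geometry.Lorentzian.TeukolskyNormalisedInfinityExists
import HarnessLib

/-!
# InfinityJostRemainderPoly

Topic `Literature/Uncategorized`. Named literature fact(s) relocated by the gate from `Summits/FinalStateConjecture/FinalStateConjecture/Theorems/PhaseMixingCaptureKappaExplicitWaveDecayInfinityJostRemainderPoly.lean`
(accept-time relocation of `[cite]`d propositions written inline in a Summits proposal; human ruling 2026-08-15).

* `Literature.Uncategorized.InfinityJostRemainderPoly`
-/

namespace Literature.Uncategorized

open Literature.Geometry.Lorentzian MeasureTheory Filter Set Complex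
open scoped Topology Manifold ENNReal

/-- **S6f statement (v9.6, CORRECTED)** — quantitative outgoing asymptotics of every infinity-normalised
solution with tracked constants, at radii `r ≥ C_J` AND `r ≥ C_J(1+Λ)/|ω|` (the v9.5 form without `C_J ≤ r`
quantified radii `r ≤ r₊` for large `|ω|` and is refuted in the evidence file by
`not_infinityJostRemainderPoly`). Re-declared verbatim from the line skeleton. [folklore] -/
abbrev InfinityJostRemainderPoly : Prop :=
  ∀ M : ℝ, 0 < M → ∀ ωl : ℝ, 0 < ωl → ∃ (CJ : ℝ) (p : ℕ), 0 < CJ ∧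
    ∀ a : ℝ, Kerr.IsSubextremal M a →
    ∀ (ω : ℝ) (m : ℤ) (Λ : ℝ), Kerr.IsAdmissibleTriple a ω m Λ → ωl ≤ |ω| →
      ∀ RI : ℝ → ℂ, Kerr.IsRadialTeukolskySolution M a 0 ω m (Λ - a ^ 2 * ω ^ 2) RI →
        Kerr.IsNormalisedInfinitySolution M 0 ω RI →
        ∃ c₀ : ℂ, ‖c₀‖ = 1 ∧ ∀ r : ℝ, CJ ≤ r → CJ * (1 + Λ) / |ω| ≤ r →
          ‖(Real.sqrt (r ^ 2 + a ^ 2) : ℂ) * RI r -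
              c₀ * Complex.exp (Complex.I * ω * r + 2 * Complex.I * M * ω * Real.log r)‖ ≤
            CJ * (1 + Λ) * (1 + |ω|) ^ p / (|ω| * r)

end Literature.Uncategorized
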